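import Literature.MathematicalPhysics.QuantumLattice.FinDimSpectrumSectorGibbsLimit
import Mathlib.Topology.Algebra.Module.Cardinality
import Mathlib.Analysis.Convex.Function
import HarnessLib

/-!
# Griffiths' lemma for the sector ground states of an affine Hermitian pencil

For Hermitian matrices `H`, `Y` on `ℂⁿ`, a subspace ("sector") `K ≤ ℂⁿ` and the affine pencil
`s ↦ H + s Y` (`s ∈ ℝ`), write `e(s) = minEnergyOn (H + s Y) K` (`Matrix.minEnergyOn`, the bottom
of the Rayleigh quotient on the unit sphere of `K`) and call a unit vector `ψ ∈ K` with
`re ⟨ψ, (H + s Y) ψ⟩ = e(s)` a (variational) *sector ground state at coupling `s`* (every sector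
ground EIGENvector — `ψ ∈ K`, `(H + sY) ψ = e(s) ψ` — is one). The conjugate observable `Y = ∂ₛ(H + sY)`
of the pencil obeys:

* `minEnergyOn_pencil_le_of_ground` — the **supergradient inequality**
  `e(t) ≤ e(s) + (t - s) · re ⟨ψ, Y ψ⟩` for every sector ground state `ψ` at `s` and every `t`
  (the variational principle at `t` with trial state `ψ`): `re ⟨ψ, Y ψ⟩` is a supergradient of the
  concave function `e` at `s` (`concaveOn_minEnergyOn_pencil`).
* `re_rayleigh_ground_antitone` — for `s < t`, a ground state `φ` at `t` is `Y`-poorer than a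
  ground state `ψ` at `s`: `re ⟨φ, Y φ⟩ ≤ re ⟨ψ, Y ψ⟩` (supergradients of a concave function are
  antitone).
* `countable_setOf_exists_ground_re_rayleigh_lt` — **Griffiths' lemma, countable form**: the set of
  couplings `s` at which two sector ground states have DIFFERENT `Y`-expectations is countable.
  (At such an `s` the open interval between the two expectations is non-empty; by antitonicity the
  intervals belonging to distinct exceptional couplings are disjoint; a disjoint family of non-empty
  open real intervals is countable, Mathlib `Set.PairwiseDisjoint.countable_of_isOpen`.) Hence off a
  countable set of couplings ALL sector ground states at `s` share one value of `re ⟨·, Y ·⟩` — the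
  ground-state "average" of the conjugate observable equals its value in "every" ground state
  (`countable_setOf_not_forall_ground_re_rayleigh_eq`).
* `countable_setOf_exists_not_forall_ground_re_rayleigh_eq`, `dense_setOf_forall_ground_re_rayleigh_eq`,
  `exists_mem_Ioo_forall_ground_re_rayleigh_eq` — the same for a COUNTABLE FAMILY of pencils
  `(H i, Y i, K i)` (e.g. one for every finite volume): off one countable set of couplings the
  conclusion holds for every member simultaneously; in particular in every open window `(a, b)`.

This is the finite-dimensional, zero-temperature form of Griffiths' argument (Phys. Rev. 152 (1966)
240, §II–III: the one-sided derivatives of the concave energy/free energy in a field bound the order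
parameter of every equilibrium/ground state, and a concave function is differentiable off a
countable set — Rockafellar (1970) Thm. 25.3), cf. Simon (1993) §I–II (tangent functionals),
Koma–Tasaki (1994) §1, Kato (1966) II-§6.1 (first-order perturbation of eigenvalues of Hermitian
pencils), Tasaki (2020) §2.1–2.2 (variational principle in a sector). The proof given here avoids
derivatives altogether (disjoint open intervals). No definition is introduced.

## Mathlib / tree search

REUSED: `minEnergyOn_le_rayleigh_of_mem` (`FinDimSpectrumSectorGibbsLimit`, the variational
principle in a sector), `SectorSpectrum.exists_smul_unit`, Mathlib `Set.PairwiseDisjoint.countable_of_isOpen`,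
`Set.Countable.dense_compl`, `Dense.exists_mem_open`, `Set.countable_iUnion`. `lean search`
"countable.*minEnergyOn|supergradient|PairwiseDisjoint" in `Literature/MathematicalPhysics`: no hit;
the one-`κ` chord inequalities exist on the Summits side (route BalabanIR, crux 5) but not the
countable-exceptional-set statement.

## References

* R. B. Griffiths, *Spontaneous magnetization in idealized ferromagnets*, Phys. Rev. 152 (1966)
  240–246, §II–III. [Griffiths1966]
* R. T. Rockafellar, *Convex Analysis*, Princeton 1970, Thm. 25.3 (a convex function on an open
  real interval is differentiable off a countable set). [Rockafellar1970]
* T. Koma, H. Tasaki, *Symmetry breaking and finite-size effects in quantum many-body systems*,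
  J. Stat. Phys. 76 (1994) 745, §1. [KomaTasaki1994]
* B. Simon, *The Statistical Mechanics of Lattice Gases* I, Princeton 1993, §I–II. [Simon1993]
* T. Kato, *Perturbation Theory for Linear Operators*, Springer 1966, II-§6.1. [Kato1966]
* H. Tasaki, *Physics and Mathematics of Quantum Many-Body Systems*, Springer 2020, §2.1–2.2. [Tasaki2020]
-/

noncomputable section

namespace Literature.MathematicalPhysics.QuantumLattice

open Matrix Set

variable {n : Type*} [Fintype n] [DecidableEq n]

/-! ### The pencil and its Rayleigh quotients -/

omit [Fintype n] [DecidableEq n] in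
/-- Real multiples of a Hermitian matrix added to a Hermitian matrix stay Hermitian: every member
`H + s Y` (`s ∈ ℝ`) of the pencil is Hermitian (a private copy of
`StabilityFinalArgumentProofs.isHermitian_add_real_smul`, to keep the imports light). [folklore] -/
private theorem isHermitian_pencil_aux {H Y : Matrix n n ℂ} (hH : H.IsHermitian) (hY : Y.IsHermitian)
    (s : ℝ) : (H + (s : ℂ) • Y).IsHermitian := by
  refine hH.add ?_
  rw [IsHermitian, conjTranspose_smul, hY.eq, Complex.star_def, Complex.conj_ofReal]

omit [DecidableEq n] in
/-- The Rayleigh quotient is affine along the pencil: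
`re ⟨ψ, (H + s Y) ψ⟩ = re ⟨ψ, H ψ⟩ + s · re ⟨ψ, Y ψ⟩` (private: the same normalised statement is a
helper of several Summits files). [folklore] -/
private theorem re_rayleigh_add_real_smul (H Y : Matrix n n ℂ) (s : ℝ) (ψ : n → ℂ) :
    (star ψ ⬝ᵥ (H + (s : ℂ) • Y) *ᵥ ψ).re =
      (star ψ ⬝ᵥ H *ᵥ ψ).re + s * (star ψ ⬝ᵥ Y *ᵥ ψ).re := by
  rw [add_mulVec, dotProduct_add, Complex.add_re, smul_mulVec, dotProduct_smul, smul_eq_mul,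
    Complex.re_ofReal_mul]

omit [DecidableEq n] in
/-- A sector ground EIGENvector is a variational sector ground state: if `A ψ = minEnergyOn A K • ψ`
for a unit vector `ψ`, then `re ⟨ψ, A ψ⟩ = minEnergyOn A K` (the form in which the hypotheses of the
lemmas below are usually available). [folklore] -/
theorem re_rayleigh_of_eigen_minEnergyOn (A : Matrix n n ℂ) (K : Submodule ℂ (n → ℂ))
    {ψ : n → ℂ} (hψ : star ψ ⬝ᵥ ψ = 1) (heig : A *ᵥ ψ = ((A.minEnergyOn K : ℝ) : ℂ) • ψ) :
    (star ψ ⬝ᵥ A *ᵥ ψ).re = A.minEnergyOn K := by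
  rw [heig, dotProduct_smul, hψ, smul_eq_mul, mul_one, Complex.ofReal_re]

/-! ### The supergradient inequality and antitonicity -/

/-- **Supergradient inequality** (Feynman–Hellmann, one-sided). For Hermitian `H`, `Y`, a sector
`K` and a unit vector `ψ ∈ K` with `re ⟨ψ, (H + sY) ψ⟩ = minEnergyOn (H + sY) K` (a sector ground
state at coupling `s`): for every `t`,
`minEnergyOn (H + tY) K ≤ minEnergyOn (H + sY) K + (t - s) · re ⟨ψ, Y ψ⟩` — `ψ` is a trial state
at `t`, and its Rayleigh quotient is affine in the coupling. Griffiths, Phys. Rev. 152 (1966) 240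
§II; Tasaki (2020) §2.1. [folklore] -/
theorem minEnergyOn_pencil_le_of_ground {H Y : Matrix n n ℂ} (hH : H.IsHermitian)
    (hY : Y.IsHermitian) (K : Submodule ℂ (n → ℂ)) {s : ℝ} {ψ : n → ℂ} (hψK : ψ ∈ K)
    (hψ : star ψ ⬝ᵥ ψ = 1)
    (hground : (star ψ ⬝ᵥ (H + (s : ℂ) • Y) *ᵥ ψ).re = (H + (s : ℂ) • Y).minEnergyOn K)
    (t : ℝ) :
    (H + (t : ℂ) • Y).minEnergyOn K ≤
      (H + (s : ℂ) • Y).minEnergyOn K + (t - s) * (star ψ ⬝ᵥ Y *ᵥ ψ).re := by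
  have hle := minEnergyOn_le_rayleigh_of_mem (isHermitian_pencil_aux hH hY t) K hψK hψ
  rw [re_rayleigh_add_real_smul] at hle hground
  have hsplit : (t - s) * (star ψ ⬝ᵥ Y *ᵥ ψ).re =
      t * (star ψ ⬝ᵥ Y *ᵥ ψ).re - s * (star ψ ⬝ᵥ Y *ᵥ ψ).re := by ring
  linarith

/-- **Ground-state expectations of the conjugate observable are antitone in the coupling.** For
Hermitian `H`, `Y`, a sector `K`, couplings `s < t`, a sector ground state `ψ` at `s` and a sector
ground state `φ` at `t` (unit vectors of `K` realising `minEnergyOn`):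
`re ⟨φ, Y φ⟩ ≤ re ⟨ψ, Y ψ⟩`. (Add the two supergradient inequalities
`e(t) ≤ e(s) + (t-s) re⟨ψ,Yψ⟩` and `e(s) ≤ e(t) + (s-t) re⟨φ,Yφ⟩`.) Griffiths, Phys. Rev. 152
(1966) 240 §II; Simon (1993) §I. [folklore] -/
theorem re_rayleigh_ground_antitone {H Y : Matrix n n ℂ} (hH : H.IsHermitian)
    (hY : Y.IsHermitian) (K : Submodule ℂ (n → ℂ)) {s t : ℝ} (hst : s < t) {ψ φ : n → ℂ}
    (hψK : ψ ∈ K) (hψ : star ψ ⬝ᵥ ψ = 1)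
    (hψg : (star ψ ⬝ᵥ (H + (s : ℂ) • Y) *ᵥ ψ).re = (H + (s : ℂ) • Y).minEnergyOn K)
    (hφK : φ ∈ K) (hφ : star φ ⬝ᵥ φ = 1)
    (hφg : (star φ ⬝ᵥ (H + (t : ℂ) • Y) *ᵥ φ).re = (H + (t : ℂ) • Y).minEnergyOn K) :
    (star φ ⬝ᵥ Y *ᵥ φ).re ≤ (star ψ ⬝ᵥ Y *ᵥ ψ).re := by
  have h1 := minEnergyOn_pencil_le_of_ground hH hY K hψK hψ hψg t
  have h2 := minEnergyOn_pencil_le_of_ground hH hY K hφK hφ hφg s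
  have hprod : 0 ≤ (t - s) * ((star ψ ⬝ᵥ Y *ᵥ ψ).re - (star φ ⬝ᵥ Y *ᵥ φ).re) := by
    have hring : (t - s) * ((star ψ ⬝ᵥ Y *ᵥ ψ).re - (star φ ⬝ᵥ Y *ᵥ φ).re) =
        (t - s) * (star ψ ⬝ᵥ Y *ᵥ ψ).re + (s - t) * (star φ ⬝ᵥ Y *ᵥ φ).re := by ring
    rw [hring]
    linarith
  exact sub_nonneg.mp ((mul_nonneg_iff_of_pos_left (sub_pos.mpr hst)).mp hprod)

/-! ### Griffiths' lemma: the exceptional couplings are countable -/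

/-- **Griffiths' lemma (countable form).** For Hermitian `H`, `Y` and a sector `K`, the set of
couplings `s ∈ ℝ` at which the pencil `H + sY` has two sector ground states (unit vectors of `K`
realising `minEnergyOn (H + sY) K`) with different expectations `re ⟨ψ, Y ψ⟩ < re ⟨φ, Y φ⟩` of the
conjugate observable is COUNTABLE. Proof: to an exceptional `s` attach the non-empty open set
`F s = ⋃ (re⟨ψ,Yψ⟩, re⟨φ,Yφ⟩)` over such pairs; for exceptional `s < t` the sets `F s`, `F t` are
disjoint by `re_rayleigh_ground_antitone` (every ground expectation at `t` is `≤` every ground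
expectation at `s`); a disjoint family of non-empty open subsets of `ℝ` is countable. This is the
zero-temperature matrix form of "a concave function is differentiable off a countable set, and at
a point of differentiability every tangent functional takes the same value on the conjugate
variable" (Rockafellar (1970) Thm. 25.3). Griffiths, Phys. Rev. 152 (1966) 240 §III; Simon (1993) §II.
[cite: Griffiths1966, §III] -/
theorem countable_setOf_exists_ground_re_rayleigh_lt {H Y : Matrix n n ℂ} (hH : H.IsHermitian)
    (hY : Y.IsHermitian) (K : Submodule ℂ (n → ℂ)) :
    Set.Countable {s : ℝ | ∃ ψ φ : n → ℂ,
      (ψ ∈ K ∧ star ψ ⬝ᵥ ψ = 1 ∧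
        (star ψ ⬝ᵥ (H + (s : ℂ) • Y) *ᵥ ψ).re = (H + (s : ℂ) • Y).minEnergyOn K) ∧
      (φ ∈ K ∧ star φ ⬝ᵥ φ = 1 ∧
        (star φ ⬝ᵥ (H + (s : ℂ) • Y) *ᵥ φ).re = (H + (s : ℂ) • Y).minEnergyOn K) ∧
      (star ψ ⬝ᵥ Y *ᵥ ψ).re < (star φ ⬝ᵥ Y *ᵥ φ).re} := by
  -- ground states at coupling `s`, the `Y`-expectation, and the open sets `F s`
  set G : ℝ → (n → ℂ) → Prop := fun s ψ => ψ ∈ K ∧ star ψ ⬝ᵥ ψ = 1 ∧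
    (star ψ ⬝ᵥ (H + (s : ℂ) • Y) *ᵥ ψ).re = (H + (s : ℂ) • Y).minEnergyOn K
  set y : (n → ℂ) → ℝ := fun ψ => (star ψ ⬝ᵥ Y *ᵥ ψ).re
  set E : Set ℝ := {s : ℝ | ∃ ψ φ : n → ℂ, G s ψ ∧ G s φ ∧ y ψ < y φ}
  let F : ℝ → Set ℝ := fun s => ⋃ (ψ : n → ℂ) (φ : n → ℂ) (_ : G s ψ ∧ G s φ), Ioo (y ψ) (y φ)
  have hmemF : ∀ s x, x ∈ F s ↔ ∃ ψ φ : n → ℂ, (G s ψ ∧ G s φ) ∧ y ψ < x ∧ x < y φ := by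
    intro s x
    simp only [F, mem_iUnion, mem_Ioo, exists_prop]
  -- antitonicity across two couplings, in terms of `G`
  have hanti : ∀ {s t : ℝ}, s < t → ∀ {ψ φ : n → ℂ}, G s ψ → G t φ → y φ ≤ y ψ := by
    intro s t hst ψ φ hψ hφ
    exact re_rayleigh_ground_antitone hH hY K hst hψ.1 hψ.2.1 hψ.2.2 hφ.1 hφ.2.1 hφ.2.2
  have hopen : ∀ s ∈ E, IsOpen (F s) := fun s _ =>
    isOpen_iUnion fun _ => isOpen_iUnion fun _ => isOpen_iUnion fun _ => isOpen_Ioo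
  have hne : ∀ s ∈ E, (F s).Nonempty := by
    rintro s ⟨ψ, φ, hψ, hφ, hlt⟩
    obtain ⟨x, hx⟩ := nonempty_Ioo.mpr hlt
    exact ⟨x, (hmemF s x).mpr ⟨ψ, φ, ⟨hψ, hφ⟩, hx.1, hx.2⟩⟩
  have hdisj : E.PairwiseDisjoint F := by
    intro s _ t _ hst
    rw [Function.onFun, Set.disjoint_iff]
    rintro x ⟨hxs, hxt⟩
    obtain ⟨ψ, φ, ⟨hψ, hφ⟩, hψx, hxφ⟩ := (hmemF s x).mp hxs
    obtain ⟨ψ', φ', ⟨hψ', hφ'⟩, hψ'x, hxφ'⟩ := (hmemF t x).mp hxt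
    rcases lt_or_gt_of_ne hst with h | h
    · -- `s < t`: the `t`-ground value `y φ'` is `≤` the `s`-ground value `y ψ`
      exact absurd ((hxφ'.trans_le (hanti h hψ hφ')).trans hψx) (lt_irrefl x)
    · exact absurd ((hxφ.trans_le (hanti h hψ' hφ)).trans hψ'x) (lt_irrefl x)
  exact hdisj.countable_of_isOpen hopen hne

/-- **Off a countable set of couplings, all sector ground states share the expectation of the
conjugate observable.** For Hermitian `H`, `Y` and a sector `K`, the set of couplings `s` at which
NOT all sector ground states of `H + sY` (unit vectors of `K` realising `minEnergyOn`) have the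
same `re ⟨·, Y ·⟩` is countable (`countable_setOf_exists_ground_re_rayleigh_lt` and totality of `<`).
Griffiths, Phys. Rev. 152 (1966) 240 §III. [cite: Griffiths1966, §III] -/
theorem countable_setOf_not_forall_ground_re_rayleigh_eq {H Y : Matrix n n ℂ}
    (hH : H.IsHermitian) (hY : Y.IsHermitian) (K : Submodule ℂ (n → ℂ)) :
    Set.Countable {s : ℝ | ¬ ∀ ψ φ : n → ℂ,
      ψ ∈ K → star ψ ⬝ᵥ ψ = 1 →
        (star ψ ⬝ᵥ (H + (s : ℂ) • Y) *ᵥ ψ).re = (H + (s : ℂ) • Y).minEnergyOn K →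
      φ ∈ K → star φ ⬝ᵥ φ = 1 →
        (star φ ⬝ᵥ (H + (s : ℂ) • Y) *ᵥ φ).re = (H + (s : ℂ) • Y).minEnergyOn K →
      (star ψ ⬝ᵥ Y *ᵥ ψ).re = (star φ ⬝ᵥ Y *ᵥ φ).re} := by
  refine (countable_setOf_exists_ground_re_rayleigh_lt hH hY K).mono ?_
  intro s hs
  simp only [mem_setOf_eq, not_forall, exists_prop] at hs
  obtain ⟨ψ, φ, hψK, hψ, hψg, hφK, hφ, hφg, hne⟩ := hs
  rcases lt_or_gt_of_ne hne with h | h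
  · exact ⟨ψ, φ, ⟨hψK, hψ, hψg⟩, ⟨hφK, hφ, hφg⟩, h⟩
  · exact ⟨φ, ψ, ⟨hφK, hφ, hφg⟩, ⟨hψK, hψ, hψg⟩, h⟩

/-! ### A countable family of pencils (all finite volumes at once) -/

section Family

variable {ι : Type*} [Countable ι] {m : ι → Type*} [∀ i, Fintype (m i)] [∀ i, DecidableEq (m i)]

/-- **Griffiths' lemma for a countable family.** For a countable family of Hermitian pencils
`H i + s Y i` with sectors `K i` (e.g. one for every finite volume and particle number), the set of
couplings `s` at which SOME member has two sector ground states with different `re ⟨·, Y i ·⟩` is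
countable (countable union of `countable_setOf_not_forall_ground_re_rayleigh_eq`).
Griffiths, Phys. Rev. 152 (1966) 240 §III. [cite: Griffiths1966, §III] -/
theorem countable_setOf_exists_not_forall_ground_re_rayleigh_eq
    (H Y : ∀ i, Matrix (m i) (m i) ℂ) (hH : ∀ i, (H i).IsHermitian)
    (hY : ∀ i, (Y i).IsHermitian) (K : ∀ i, Submodule ℂ (m i → ℂ)) :
    Set.Countable {s : ℝ | ∃ i, ¬ ∀ ψ φ : m i → ℂ,
      ψ ∈ K i → star ψ ⬝ᵥ ψ = 1 →
        (star ψ ⬝ᵥ (H i + (s : ℂ) • Y i) *ᵥ ψ).re = (H i + (s : ℂ) • Y i).minEnergyOn (K i) →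
      φ ∈ K i → star φ ⬝ᵥ φ = 1 →
        (star φ ⬝ᵥ (H i + (s : ℂ) • Y i) *ᵥ φ).re = (H i + (s : ℂ) • Y i).minEnergyOn (K i) →
      (star ψ ⬝ᵥ Y i *ᵥ ψ).re = (star φ ⬝ᵥ Y i *ᵥ φ).re} := by
  have h := Set.countable_iUnion fun i =>
    countable_setOf_not_forall_ground_re_rayleigh_eq (hH i) (hY i) (K i)
  refine h.mono ?_
  rintro s ⟨i, hi⟩
  exact mem_iUnion.mpr ⟨i, hi⟩

/-- **The good couplings are dense.** For a countable family of Hermitian pencils with sectors,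
the couplings `s` at which, in EVERY member, all sector ground states share the expectation of the
conjugate observable form a dense subset of `ℝ` (complement of a countable set,
`Set.Countable.dense_compl`). Griffiths, Phys. Rev. 152 (1966) 240 §III. [cite: Griffiths1966, §III] -/
theorem dense_setOf_forall_ground_re_rayleigh_eq
    (H Y : ∀ i, Matrix (m i) (m i) ℂ) (hH : ∀ i, (H i).IsHermitian)
    (hY : ∀ i, (Y i).IsHermitian) (K : ∀ i, Submodule ℂ (m i → ℂ)) :
    Dense {s : ℝ | ∀ i, ∀ ψ φ : m i → ℂ,
      ψ ∈ K i → star ψ ⬝ᵥ ψ = 1 →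
        (star ψ ⬝ᵥ (H i + (s : ℂ) • Y i) *ᵥ ψ).re = (H i + (s : ℂ) • Y i).minEnergyOn (K i) →
      φ ∈ K i → star φ ⬝ᵥ φ = 1 →
        (star φ ⬝ᵥ (H i + (s : ℂ) • Y i) *ᵥ φ).re = (H i + (s : ℂ) • Y i).minEnergyOn (K i) →
      (star ψ ⬝ᵥ Y i *ᵥ ψ).re = (star φ ⬝ᵥ Y i *ᵥ φ).re} := by
  have hd := Set.Countable.dense_compl ℝ
    (countable_setOf_exists_not_forall_ground_re_rayleigh_eq H Y hH hY K)
  refine hd.mono ?_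
  intro s hs
  simp only [mem_compl_iff, mem_setOf_eq, not_exists, not_not] at hs
  exact hs

/-- **A good coupling in every window.** For a countable family of Hermitian pencils with sectors
and every non-trivial open window `(a, b)` of couplings, some `s ∈ (a, b)` is such that in EVERY
member of the family all sector ground states of `H i + s Y i` have the same `re ⟨·, Y i ·⟩` —
"AVERAGE = EVERY for the conjugate observable at a co-countable, hence dense, set of couplings".
Griffiths, Phys. Rev. 152 (1966) 240 §III. [cite: Griffiths1966, §III] -/
theorem exists_mem_Ioo_forall_ground_re_rayleigh_eq
    (H Y : ∀ i, Matrix (m i) (m i) ℂ) (hH : ∀ i, (H i).IsHermitian)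
    (hY : ∀ i, (Y i).IsHermitian) (K : ∀ i, Submodule ℂ (m i → ℂ)) {a b : ℝ} (hab : a < b) :
    ∃ s ∈ Set.Ioo a b, ∀ i, ∀ ψ φ : m i → ℂ,
      ψ ∈ K i → star ψ ⬝ᵥ ψ = 1 →
        (star ψ ⬝ᵥ (H i + (s : ℂ) • Y i) *ᵥ ψ).re = (H i + (s : ℂ) • Y i).minEnergyOn (K i) →
      φ ∈ K i → star φ ⬝ᵥ φ = 1 →
        (star φ ⬝ᵥ (H i + (s : ℂ) • Y i) *ᵥ φ).re = (H i + (s : ℂ) • Y i).minEnergyOn (K i) →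
      (star ψ ⬝ᵥ Y i *ᵥ ψ).re = (star φ ⬝ᵥ Y i *ᵥ φ).re := by
  obtain ⟨s, hs, hmem⟩ :=
    (dense_setOf_forall_ground_re_rayleigh_eq H Y hH hY K).exists_mem_open isOpen_Ioo
      (nonempty_Ioo.mpr hab)
  exact ⟨s, hmem, hs⟩

end Family

/-! ### Concavity of the sector energy along the pencil -/

/-- **The sector energy is concave along an affine pencil.** For Hermitian `H`, `Y` and a sector
`K ≠ ⊥`, `s ↦ minEnergyOn (H + sY) K` is concave on `ℝ`: an infimum, over the unit vectors `ψ`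
of `K`, of the affine functions `s ↦ re ⟨ψ, H ψ⟩ + s re ⟨ψ, Y ψ⟩`. Griffiths, Phys. Rev. 152 (1966)
240 §II; Koma–Tasaki, J. Stat. Phys. 76 (1994) 745 §1; Tasaki (2020) §2.1. [folklore] -/
theorem concaveOn_minEnergyOn_pencil {H Y : Matrix n n ℂ} (hH : H.IsHermitian)
    (hY : Y.IsHermitian) {K : Submodule ℂ (n → ℂ)} (hK : K ≠ ⊥) :
    ConcaveOn ℝ Set.univ (fun s : ℝ => (H + (s : ℂ) • Y).minEnergyOn K) := by
  refine ⟨convex_univ, fun x _ z _ a b ha hb hab => ?_⟩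
  obtain ⟨v, hvK, hv0⟩ := (Submodule.ne_bot_iff K).1 hK
  obtain ⟨c, -, hc1⟩ := exists_smul_unit hv0
  have hne : ∃ ψ ∈ K, star ψ ⬝ᵥ ψ = 1 := ⟨c • v, K.smul_mem c hvK, hc1⟩
  simp only [smul_eq_mul]
  refine le_csInf ?_ ?_
  · obtain ⟨ψ, hψ, h1⟩ := hne
    exact ⟨_, ψ, hψ, h1, rfl⟩
  · rintro E ⟨ψ, hψ, h1, rfl⟩
    have hx := minEnergyOn_le_rayleigh_of_mem (isHermitian_pencil_aux hH hY x) K hψ h1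
    have hz := minEnergyOn_le_rayleigh_of_mem (isHermitian_pencil_aux hH hY z) K hψ h1
    rw [re_rayleigh_add_real_smul] at hx hz ⊢
    have key : a * ((star ψ ⬝ᵥ H *ᵥ ψ).re + x * (star ψ ⬝ᵥ Y *ᵥ ψ).re) +
        b * ((star ψ ⬝ᵥ H *ᵥ ψ).re + z * (star ψ ⬝ᵥ Y *ᵥ ψ).re) =
        (star ψ ⬝ᵥ H *ᵥ ψ).re + (a * x + b * z) * (star ψ ⬝ᵥ Y *ᵥ ψ).re := by
      have : a * (star ψ ⬝ᵥ H *ᵥ ψ).re + b * (star ψ ⬝ᵥ H *ᵥ ψ).re =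
          (star ψ ⬝ᵥ H *ᵥ ψ).re := by rw [← add_mul, hab, one_mul]
      linear_combination this
    rw [← key]
    nlinarith [mul_le_mul_of_nonneg_left hx ha, mul_le_mul_of_nonneg_left hz hb]

end Literature.MathematicalPhysics.QuantumLattice
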